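import Summits.HubbardSuperconductivity.HubbardSuperconductivity.Theorems.NodalWardXYNodalPropagatorDecayGeometry
import Summits.HubbardSuperconductivity.HubbardSuperconductivity.Theses.NodalWardXY
import Literature.Analysis.Complex.StripResidueFormula

/-!
# Nodal propagator decay (route `NodalWardXY`, item `NodalPropagatorDecay`): IV. the integrand,
# the trivial bound and the `τ`-decay

The integrand of the item is written through local notations `ξ⟪μ,p⟫, Δ⟪Δ₀,p⟫, E⟪μ,Δ₀,p⟫`
(BdG data), `W⟪μ,Δ₀,j,p⟫ = ![1, ξ/E, Δ/E] j` (Nambu weights) and `Φ⟪μ,Δ₀,m₀,m₁,τ,j,p⟫`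
(phase × `e^{-|τ|E}` × weight); an `Iff.rfl` example checks that this IS the route decl.
Then: `‖Φ‖ ≤ e^{-|τ|E} ≤ 1`, the trivial bound `‖∫_{[-π,π]²} Φ‖ ≤ 4π²`, and the `τ`-decay
`‖∫ Φ‖ ≤ C(μ,Δ₀)/τ²` from the conical lower bound `E ≥ 2 min(1,Δ₀) κ (||p₁|-n₀| + ||p₂|-n₀|)`
(file III) and `∫_ℝ e^{-k|t∓n₀|} dt = 2/k`.  No definitions.
-/

noncomputable section

namespace Summit.HubbardSuperconductivity.HubbardSuperconductivity.Theorems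

namespace NodalDecay

open Real MeasureTheory intervalIntegral

/-! ### The integrand of the item (local notation) -/

local notation "ξ⟪" μ ", " p "⟫" => -2 * (Real.cos (Prod.fst p) + Real.cos (Prod.snd p)) - μ
local notation "Δ⟪" Δ₀ ", " p "⟫" => 2 * Δ₀ * (Real.cos (Prod.fst p) - Real.cos (Prod.snd p))
local notation "E⟪" μ ", " Δ₀ ", " p "⟫" => Real.sqrt (ξ⟪μ, p⟫ ^ 2 + Δ⟪Δ₀, p⟫ ^ 2)
local notation "W⟪" μ ", " Δ₀ ", " j ", " p "⟫" =>
  (![(1:ℝ), ξ⟪μ, p⟫ / E⟪μ, Δ₀, p⟫, Δ⟪Δ₀, p⟫ / E⟪μ, Δ₀, p⟫] : Fin 3 → ℝ) j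
local notation "Φ⟪" μ ", " Δ₀ ", " m₀ ", " m₁ ", " τ ", " j ", " p "⟫" =>
  Complex.exp (Complex.I * (((Prod.fst p) * ((m₀ : ℤ) : ℝ) + (Prod.snd p) * ((m₁ : ℤ) : ℝ) : ℝ) : ℂ))
    * ((Real.exp (-|τ| * E⟪μ, Δ₀, p⟫) : ℝ) : ℂ) * ((W⟪μ, Δ₀, j, p⟫ : ℝ) : ℂ)
set_option quotPrecheck false in
local notation "box" => Set.Icc (-Real.pi) Real.pi ×ˢ Set.Icc (-Real.pi) Real.pi


/-- Sanity check: the item, restated through the local notation, is definitionally the route decl. -/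
example : Summit.HubbardSuperconductivity.HubbardSuperconductivity.Theses.NodalWardXY.NodalPropagatorDecay ↔
    ∀ μ : ℝ, μ ∈ Set.Ioo (-4 : ℝ) 4 → μ ≠ 0 → ∀ Δ₀ : ℝ, 0 < Δ₀ → ∃ C : ℝ,
      ∀ (x : Fin 2 → ℤ) (τ : ℝ) (j : Fin 3),
        ‖∫ p in box, Φ⟪μ, Δ₀, x 0, x 1, τ, j, p⟫‖ ≤ C / (1 + |(x 0 : ℝ)| + |(x 1 : ℝ)| + |τ|) ^ 2 :=
  Iff.rfl

/-! ### Pointwise bounds on the integrand -/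

/-- The Nambu weights are bounded by one: `|w_j| ≤ 1`. -/
theorem abs_weight_le_one (μ Δ₀ : ℝ) (j : Fin 3) (p : ℝ × ℝ) : |W⟪μ, Δ₀, j, p⟫| ≤ 1 := by
  have hE : 0 ≤ E⟪μ, Δ₀, p⟫ := Real.sqrt_nonneg _
  have h1 : |ξ⟪μ, p⟫| ≤ E⟪μ, Δ₀, p⟫ := Real.abs_le_sqrt (by nlinarith)
  have h2 : |Δ⟪Δ₀, p⟫| ≤ E⟪μ, Δ₀, p⟫ := Real.abs_le_sqrt (by nlinarith)
  fin_cases j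
  · simp
  · simp only [Fin.mk_one, Matrix.cons_val_one, Matrix.cons_val_zero]
    rw [abs_div, abs_of_nonneg hE]
    exact div_le_one_of_le₀ h1 hE
  · simp only [Fin.reduceFinMk, Matrix.cons_val]
    rw [abs_div, abs_of_nonneg hE]
    exact div_le_one_of_le₀ h2 hE

/-- `‖Φ(p)‖ ≤ e^{-|τ| E(p)}`. -/
theorem norm_integrand_le (μ Δ₀ : ℝ) (m₀ m₁ : ℤ) (τ : ℝ) (j : Fin 3) (p : ℝ × ℝ) :
    ‖Φ⟪μ, Δ₀, m₀, m₁, τ, j, p⟫‖ ≤ Real.exp (-|τ| * E⟪μ, Δ₀, p⟫) := by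
  rw [norm_mul, norm_mul, Complex.norm_real, Complex.norm_real, Real.norm_eq_abs, Real.norm_eq_abs,
    abs_of_pos (Real.exp_pos _), mul_comm Complex.I, Complex.norm_exp_ofReal_mul_I, one_mul]
  have := abs_weight_le_one μ Δ₀ j p
  have := Real.exp_pos (-|τ| * E⟪μ, Δ₀, p⟫)
  calc Real.exp (-|τ| * E⟪μ, Δ₀, p⟫) * |W⟪μ, Δ₀, j, p⟫| ≤ Real.exp (-|τ| * E⟪μ, Δ₀, p⟫) * 1 := by
        gcongr
    _ = _ := mul_one _

/-- `‖Φ(p)‖ ≤ 1`. -/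
theorem norm_integrand_le_one (μ Δ₀ : ℝ) (m₀ m₁ : ℤ) (τ : ℝ) (j : Fin 3) (p : ℝ × ℝ) :
    ‖Φ⟪μ, Δ₀, m₀, m₁, τ, j, p⟫‖ ≤ 1 := by
  refine (norm_integrand_le μ Δ₀ m₀ m₁ τ j p).trans ?_
  rw [Real.exp_le_one_iff]
  have := Real.sqrt_nonneg (ξ⟪μ, p⟫ ^ 2 + Δ⟪Δ₀, p⟫ ^ 2)
  have := abs_nonneg τ
  nlinarith

/-! ### The trivial bound -/

/-- The momentum box `[-π, π]²` has Lebesgue measure `4π²`. -/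
theorem volume_box : MeasureTheory.volume (box) = ENNReal.ofReal (2 * π) * ENNReal.ofReal (2 * π) := by
  rw [Measure.volume_eq_prod, Measure.prod_prod, Real.volume_Icc]
  congr 1 <;> ring_nf

/-- `‖∫_{[-π,π]²} Φ‖ ≤ 4π²`. -/
theorem norm_integral_le_const (μ Δ₀ : ℝ) (m₀ m₁ : ℤ) (τ : ℝ) (j : Fin 3) :
    ‖∫ p in box, Φ⟪μ, Δ₀, m₀, m₁, τ, j, p⟫‖ ≤ 4 * π ^ 2 := by
  have hvol : MeasureTheory.volume (box) < ⊤ := by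
    rw [volume_box]; exact ENNReal.mul_lt_top ENNReal.ofReal_lt_top ENNReal.ofReal_lt_top
  have h := norm_setIntegral_le_of_norm_le_const hvol
    (fun p _ => norm_integrand_le_one μ Δ₀ m₀ m₁ τ j p)
  refine h.trans (le_of_eq ?_)
  rw [measureReal_def, volume_box, ENNReal.toReal_mul, ENNReal.toReal_ofReal (by positivity)]
  ring

/-! ### The `τ`-decay bound -/

/-- `∫_ℝ e^{-c|s|} ds = 2/c` for `c > 0`. -/
theorem integral_exp_neg_mul_abs_eq {c : ℝ} (hc : 0 < c) : ∫ s, Real.exp (-c * |s|) = 2 / c := by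
  calc ∫ s, Real.exp (-c * |s|) = 2 * ∫ s in Set.Ioi 0, Real.exp (-c * s) :=
        integral_comp_abs (f := fun s => Real.exp (-c * s))
    _ = 2 / c := by
        rw [integral_exp_mul_Ioi (by linarith) 0, mul_zero, Real.exp_zero]
        field_simp

/-- The one-dimensional majorant `g(t) = e^{-k|t - n₀|} + e^{-k|t + n₀|}` has `∫_ℝ g = 4/k`. -/
theorem integral_twoSided_exp {k : ℝ} (hk : 0 < k) (n₀ : ℝ) :
    ∫ t, (Real.exp (-k * |t - n₀|) + Real.exp (-k * |t + n₀|)) = 4 / k := by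
  have hI := Literature.Analysis.Complex.integrable_exp_neg_mul_abs hk
  rw [integral_add (hI.comp_sub_right n₀) (hI.comp_add_right n₀),
    integral_sub_right_eq_self (fun t => Real.exp (-k * |t|)) n₀,
    integral_add_right_eq_self (fun t => Real.exp (-k * |t|)) n₀, integral_exp_neg_mul_abs_eq hk]
  ring

/-- **`τ`-decay.**  For `μ ∈ (-4, 4)` and `Δ₀ > 0` there is `C` with
`‖∫_{[-π,π]²} Φ‖ ≤ C / τ²` for all `τ ≠ 0` (and all `m₀, m₁, j`). -/
theorem norm_integral_le_tau {μ Δ₀ : ℝ} (hμ : μ ∈ Set.Ioo (-4 : ℝ) 4) (hΔ : 0 < Δ₀) :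
    ∃ C : ℝ, ∀ (m₀ m₁ : ℤ) (τ : ℝ) (j : Fin 3), τ ≠ 0 →
      ‖∫ p in box, Φ⟪μ, Δ₀, m₀, m₁, τ, j, p⟫‖ ≤ C / τ ^ 2 := by
  -- the node angle
  set n₀ := Real.arccos (-μ / 4) with hn₀
  have hn₀pos : 0 < n₀ := Real.arccos_pos.2 (by linarith [hμ.1, hμ.2])
  have hn₀pi : n₀ < π := Real.arccos_lt_pi.2 (by linarith [hμ.1, hμ.2])
  have hcosn₀ : Real.cos n₀ = -μ / 4 :=
    Real.cos_arccos (by linarith [hμ.1, hμ.2]) (by linarith [hμ.1, hμ.2])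
  obtain ⟨κ, hκ, hcos⟩ := abs_cos_sub_cos_ge hn₀pos hn₀pi
  set d := min 1 Δ₀ with hd
  have hdpos : 0 < d := lt_min one_pos hΔ
  set c := 2 * d * κ with hc
  have hcpos : 0 < c := by positivity
  refine ⟨16 / c ^ 2, fun m₀ m₁ τ j hτ => ?_⟩
  have hτpos : 0 < |τ| := abs_pos.2 hτ
  set k := c * |τ| with hk
  have hkpos : 0 < k := by positivity
  -- one-dimensional majorant
  set g : ℝ → ℝ := fun t => Real.exp (-k * |t - n₀|) + Real.exp (-k * |t + n₀|) with hg
  have hg_cont : Continuous g := by simp only [hg]; fun_prop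
  have hg_nonneg : ∀ t, 0 ≤ g t := fun t => by simp only [hg]; positivity
  have hg_int : Integrable g := by
    have hI := Literature.Analysis.Complex.integrable_exp_neg_mul_abs hkpos
    exact (hI.comp_sub_right n₀).add (hI.comp_add_right n₀)
  have hg_dom : ∀ t : ℝ, |t| ≤ π → Real.exp (-k * |(|t| - n₀)|) ≤ g t := by
    intro t _
    simp only [hg]
    rcases le_or_gt 0 t with h | h
    · rw [abs_of_nonneg h]
      linarith [Real.exp_pos (-k * |t + n₀|)]
    · rw [abs_of_neg h, show |-t - n₀| = |t + n₀| by rw [← abs_neg]; ring_nf]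
      linarith [Real.exp_pos (-k * |t - n₀|)]
  -- pointwise domination on the box
  have hdom : ∀ p ∈ box, ‖Φ⟪μ, Δ₀, m₀, m₁, τ, j, p⟫‖ ≤ g p.1 * g p.2 := by
    intro p hp
    rw [Set.mem_prod, Set.mem_Icc, Set.mem_Icc] at hp
    have h1 : |p.1| ≤ π := abs_le.2 ⟨hp.1.1, hp.1.2⟩
    have h2 : |p.2| ≤ π := abs_le.2 ⟨hp.2.1, hp.2.2⟩
    refine (norm_integrand_le μ Δ₀ m₀ m₁ τ j p).trans ?_
    have hE := bdg_energy_ge μ Δ₀ hΔ.le p.1 p.2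
    have hc1 := hcos p.1 h1
    have hc2 := hcos p.2 h2
    rw [hcosn₀, show ∀ u : ℝ, u - -μ / 4 = u + μ / 4 from fun u => by ring] at hc1 hc2
    calc Real.exp (-|τ| * E⟪μ, Δ₀, p⟫)
        ≤ Real.exp (-k * |(|p.1| - n₀)| + -k * |(|p.2| - n₀)|) := by
          rw [Real.exp_le_exp, hk, hc]
          have : 2 * d * (κ * |(|p.1| - n₀)| + κ * |(|p.2| - n₀)|) ≤ E⟪μ, Δ₀, p⟫ :=
            le_trans (by nlinarith [hdpos.le]) hE
          nlinarith [hτpos.le]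
      _ = Real.exp (-k * |(|p.1| - n₀)|) * Real.exp (-k * |(|p.2| - n₀)|) := Real.exp_add _ _
      _ ≤ g p.1 * g p.2 :=
          mul_le_mul (hg_dom p.1 h1) (hg_dom p.2 h2) (Real.exp_pos _).le (hg_nonneg _)
  -- integrate
  have hG_int : IntegrableOn (fun p : ℝ × ℝ => g p.1 * g p.2) (box) :=
    (ContinuousOn.integrableOn_compact (isCompact_Icc.prod isCompact_Icc)
      ((hg_cont.comp continuous_fst).mul (hg_cont.comp continuous_snd)).continuousOn)
  have hbox : MeasurableSet (box) := measurableSet_Icc.prod measurableSet_Icc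
  have step1 : ‖∫ p in box, Φ⟪μ, Δ₀, m₀, m₁, τ, j, p⟫‖ ≤ ∫ p in box, g p.1 * g p.2 :=
    norm_integral_le_of_norm_le hG_int ((ae_restrict_iff' hbox).2 (ae_of_all _ hdom))
  have step2 : ∫ p in box, g p.1 * g p.2 = (∫ t in Set.Icc (-π) π, g t) * ∫ t in Set.Icc (-π) π, g t := by
    rw [Measure.volume_eq_prod]
    exact setIntegral_prod_mul g g _ _
  have step3 : ∫ t in Set.Icc (-π) π, g t ≤ 4 / k := by
    calc ∫ t in Set.Icc (-π) π, g t ≤ ∫ t, g t :=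
          setIntegral_le_integral hg_int (Filter.Eventually.of_forall hg_nonneg)
      _ = 4 / k := integral_twoSided_exp hkpos n₀
  have step4 : 0 ≤ ∫ t in Set.Icc (-π) π, g t := integral_nonneg hg_nonneg
  calc ‖∫ p in box, Φ⟪μ, Δ₀, m₀, m₁, τ, j, p⟫‖ ≤ (∫ t in Set.Icc (-π) π, g t) * ∫ t in Set.Icc (-π) π, g t := by
        rw [← step2]; exact step1
    _ ≤ (4 / k) * (4 / k) := mul_le_mul step3 step3 step4 (by positivity)
    _ = 16 / c ^ 2 / τ ^ 2 := by
        rw [hk]; field_simp; rw [sq_abs]; ring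

end NodalDecay

end Summit.HubbardSuperconductivity.HubbardSuperconductivity.Theorems
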